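import Mathlib
import Summits.Ventures.PercRepro2.Defs
import Summits.Ventures.PercRepro2.Independence
import Summits.Ventures.PercRepro2.Harris
import Summits.Ventures.PercRepro2.Graph
import Summits.Ventures.PercRepro2.Events
import Summits.Ventures.PercRepro2.BHKEvents
import Summits.Ventures.PercRepro2.XWForm
import Summits.Ventures.PercRepro2.XWHarrisSplit
import Summits.Ventures.PercRepro2.XWEdgeSY
import Summits.Ventures.PercRepro2.XWEdgeYU

/-!
# (C-yu) is a theorem: the `y–u` concavity defect of (XW) is nonnegative, and the residual of
the Harris split is never positive (PercRepro2, p2 g27)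

With `a = {s ↔ u}`, `λ = {y ↔ o}`, `S = {s ↔ y}`, `Q = Sᶜ`, the `y–u` defect of XWEdgeYU.lean is

  `D_yu = P(S ∩ aᶜ)·P(Q ∩ aᶜ ∩ λᶜ ∩ {u ↔ o}) + P(Q ∩ a)·P(S ∩ aᶜ ∩ λ) − P(S ∩ aᶜ)·P(Q ∩ a ∩ λ)`.

The first product is nonnegative, and the other two are a van den Berg–Häggström–Kahn pair
seen from the root `y` with the avoided vertex `u`: on `D = {y ↮ u}` the four cells are
`S ∩ aᶜ = D ∩ {s ∈ C_y}`, `Q ∩ a = D ∩ {s ∈ C_u}`, `S ∩ aᶜ ∩ λ = D ∩ {s ∈ C_y} ∩ {o ∈ C_y}` and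
`Q ∩ a ∩ λ = D ∩ {s ∈ C_u} ∩ {o ∈ C_y}` (connectivity is an equivalence relation), so

* BHK06 Thm 1.3 (`bhk_same_cluster_events`, the cluster of `y` is positively associated given
  `y ↮ u`): `P(D, s ∈ C_y)·P(D, o ∈ C_y) ≤ P(D, s ∈ C_y, o ∈ C_y)·P(D)`;
* BHK06 Thm 1.4 (`bhk_cross_cluster`, the clusters of `y` and `u` are negatively correlated
  given `y ↮ u`): `P(D, o ∈ C_y, s ∈ C_u)·P(D) ≤ P(D, o ∈ C_y)·P(D, s ∈ C_u)`;

multiplying, `P(S ∩ aᶜ)·P(Q ∩ a ∩ λ)·P(D) ≤ P(Q ∩ a)·P(S ∩ aᶜ ∩ λ)·P(D)`, and `P(D)` cancels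
(when `P(D) = 0` every term vanishes).  Hence `0 ≤ D_yu` (`dYU_nonneg`) for EVERY graph, every
admissible weight vector and every choice of the four marks (no distinctness needed): the
conjecture (C-yu) of record (proofs/P2-G25-XWSTRUCT.md §9, P2-G26-CSY.md §4c/§8) is a theorem,
the `y–u` and `s–o` edges are removable for (XW) (`xwBil_nonneg_of_yu_edge`,
`xwBil_nonneg_of_so_edge`, from `xwBil_nonneg_of_dYU_nonneg` / `xwBil_nonneg_of_dSO_nonneg`),
and — the same pair read at the swapped marks — the residual `q₁₁s₀₀ − q₀₁s₁₀` of the Harris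
split of (XW) (XWHarrisSplit.lean) is NEVER positive (`residualPart_nonpos`): (XW) always says
`harrisPart ≥ −residualPart` with both sides nonnegative, and `XW ≤ harrisPart`
(`xwBil_le_harrisPart`).  Own work (record proofs/P2-G27-CYU.md); standard axioms.
-/

namespace Summit.Ventures.PercRepro2

namespace XWEdgeYUNonneg

variable {V : Type*} {E : Type*} [Fintype E] [DecidableEq E] [Fintype V] [DecidableEq V]
  {R : Type*} [CommRing R] [LinearOrder R] [IsStrictOrderedRing R]

/-! ## The four cells of `D_yu` seen from the root `y` with `u` avoided -/

section Cells

variable (ends : E → Sym2 V) (s y o u : V)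

omit [Fintype E] [DecidableEq E] [Fintype V] [DecidableEq V] in
/-- `{v ∈ C(x)} = {v ↔ x}` (the family `{W | v ∈ W}` is the up-set of vertex sets containing `v`). -/
lemma clusterInEvent_mem_eq (x v : V) :
    clusterInEvent ends x {W | v ∈ W} = connEvent ends v x := by
  ext ω
  simp only [mem_clusterInEvent, Set.mem_setOf_eq, mem_cluster, mem_connEvent]
  exact ⟨conn_symm, conn_symm⟩

omit [Fintype E] [DecidableEq E] [Fintype V] [DecidableEq V] in
/-- `{W | v ∈ W}` is an up-set. -/
lemma isUpperSet_mem (v : V) : IsUpperSet {W : Set V | v ∈ W} := fun _ _ h hv => h hv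

omit [Fintype E] [DecidableEq E] [Fintype V] [DecidableEq V] in
/-- `S ∩ aᶜ = {s ↔ y} ∩ {y ↮ u}`. -/
lemma S_not_a_eq :
    connEvent ends s y ∩ (connEvent ends s u)ᶜ = connEvent ends s y ∩ (connEvent ends y u)ᶜ := by
  ext ω
  simp only [Set.mem_inter_iff, Set.mem_compl_iff, mem_connEvent]
  constructor
  · rintro ⟨h1, h2⟩
    exact ⟨h1, fun h => h2 (conn_trans h1 h)⟩
  · rintro ⟨h1, h2⟩
    exact ⟨h1, fun h => h2 (conn_trans (conn_symm h1) h)⟩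

omit [Fintype E] [DecidableEq E] [Fintype V] [DecidableEq V] in
/-- `Q ∩ a = {s ↔ u} ∩ {y ↮ u}`. -/
lemma Q_a_eq :
    (connEvent ends s y)ᶜ ∩ connEvent ends s u = connEvent ends s u ∩ (connEvent ends y u)ᶜ := by
  ext ω
  simp only [Set.mem_inter_iff, Set.mem_compl_iff, mem_connEvent]
  constructor
  · rintro ⟨h1, h2⟩
    exact ⟨h2, fun h => h1 (conn_trans h2 (conn_symm h))⟩
  · rintro ⟨h1, h2⟩
    exact ⟨fun h => h2 (conn_trans (conn_symm h) h1), h1⟩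

omit [Fintype E] [DecidableEq E] [Fintype V] [DecidableEq V] in
/-- `S ∩ aᶜ ∩ λ = {s ↔ y} ∩ {o ↔ y} ∩ {y ↮ u}`. -/
lemma S_not_a_l_eq :
    connEvent ends s y ∩ (connEvent ends s u)ᶜ ∩ connEvent ends y o =
      connEvent ends s y ∩ connEvent ends o y ∩ (connEvent ends y u)ᶜ := by
  ext ω
  simp only [Set.mem_inter_iff, Set.mem_compl_iff, mem_connEvent]
  constructor
  · rintro ⟨⟨h1, h2⟩, h3⟩
    exact ⟨⟨h1, conn_symm h3⟩, fun h => h2 (conn_trans h1 h)⟩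
  · rintro ⟨⟨h1, h3⟩, h2⟩
    exact ⟨⟨h1, fun h => h2 (conn_trans (conn_symm h1) h)⟩, conn_symm h3⟩

omit [Fintype E] [DecidableEq E] [Fintype V] [DecidableEq V] in
/-- `Q ∩ a ∩ λ = {o ↔ y} ∩ {s ↔ u} ∩ {y ↮ u}`. -/
lemma Q_a_l_eq :
    (connEvent ends s y)ᶜ ∩ connEvent ends s u ∩ connEvent ends y o =
      connEvent ends o y ∩ connEvent ends s u ∩ (connEvent ends y u)ᶜ := by
  ext ω
  simp only [Set.mem_inter_iff, Set.mem_compl_iff, mem_connEvent]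
  constructor
  · rintro ⟨⟨h1, h2⟩, h3⟩
    exact ⟨⟨conn_symm h3, h2⟩, fun h => h1 (conn_trans h2 (conn_symm h))⟩
  · rintro ⟨⟨h3, h2⟩, h1⟩
    exact ⟨⟨fun h => h1 (conn_trans (conn_symm h) h2), h2⟩, conn_symm h3⟩

end Cells

/-! ## The BHK pair -/

section Main

variable (ends : E → Sym2 V) (s y o u : V)

/-- **The BHK part of `D_yu` is nonnegative**:
`P(S ∩ aᶜ)·P(Q ∩ a ∩ λ) ≤ P(Q ∩ a)·P(S ∩ aᶜ ∩ λ)` — on `{y ↮ u}`, the same-cluster inequality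
for `{s ∈ C_y}`, `{o ∈ C_y}` (BHK06 Thm 1.3) and the cross-cluster inequality for `{o ∈ C_y}`,
`{s ∈ C_u}` (BHK06 Thm 1.4), multiplied. -/
theorem bhk_pair {p : E → R} (hp : IsProbVec p) :
    prob p (connEvent ends s y ∩ (connEvent ends s u)ᶜ) *
        prob p ((connEvent ends s y)ᶜ ∩ connEvent ends s u ∩ connEvent ends y o) ≤
      prob p ((connEvent ends s y)ᶜ ∩ connEvent ends s u) *
        prob p (connEvent ends s y ∩ (connEvent ends s u)ᶜ ∩ connEvent ends y o) := by
  rw [S_not_a_l_eq, Q_a_l_eq, S_not_a_eq, Q_a_eq]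
  -- BHK 1.3 at the root `y`, avoided `u`, for `{s ∈ C_y}` and `{o ∈ C_y}`
  have a1 := bhk_same_cluster_events p hp ends y u (isUpperSet_mem s) (isUpperSet_mem o)
  -- BHK 1.4 at the root `y`, avoided `u`, for `{o ∈ C_y}` and `{s ∈ C_u}`
  have b1 := bhk_cross_cluster p hp ends y u (isUpperSet_mem o) (isUpperSet_mem s)
  rw [clusterInEvent_mem_eq, clusterInEvent_mem_eq] at a1 b1
  -- names
  set D := (connEvent ends y u)ᶜ with hD
  set d := prob p D
  set A := prob p (connEvent ends s y ∩ D)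
  set H := prob p (connEvent ends s u ∩ D)
  set Po := prob p (connEvent ends o y ∩ D)
  set B := prob p (connEvent ends s y ∩ connEvent ends o y ∩ D)
  set Y := prob p (connEvent ends o y ∩ connEvent ends s u ∩ D)
  have hA : 0 ≤ A := prob_nonneg hp _
  have hH : 0 ≤ H := prob_nonneg hp _
  have hd : 0 ≤ d := prob_nonneg hp _
  have hAd : A ≤ d := prob_mono hp Set.inter_subset_right
  have hHd : H ≤ d := prob_mono hp Set.inter_subset_right
  -- `a1 : A * Po ≤ B * d`, `b1 : Y * d ≤ Po * H`
  have e1 := mul_le_mul_of_nonneg_left a1 hH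
  have e2 := mul_le_mul_of_nonneg_left b1 hA
  have key : A * Y * d ≤ H * B * d := by nlinarith
  rcases hd.lt_or_eq with hd0 | hd0
  · exact le_of_mul_le_mul_right key hd0
  · have hA0 : A = 0 := le_antisymm (hd0 ▸ hAd) hA
    have hH0 : H = 0 := le_antisymm (hd0 ▸ hHd) hH
    rw [hA0, hH0, zero_mul, zero_mul]

/-- **(C-yu) is a theorem**: `0 ≤ D_yu` for every graph, every admissible weight vector and
every choice of the marks `s, y, o, u`. -/
theorem dYU_nonneg {p : E → R} (hp : IsProbVec p) : 0 ≤ XWEdgeYU.dYU ends s y o u p := by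
  unfold XWEdgeYU.dYU
  have h1 : 0 ≤ prob p (connEvent ends s y ∩ (connEvent ends s u)ᶜ) *
      prob p ((connEvent ends s y)ᶜ ∩ (connEvent ends s u)ᶜ ∩ (connEvent ends y o)ᶜ ∩
        connEvent ends u o) :=
    mul_nonneg (prob_nonneg hp _) (prob_nonneg hp _)
  have h2 := bhk_pair ends s y o u hp
  linarith

/-- **The `y–u` edge is removable for (XW)**: if (XW) holds with an edge `e = {y, u}` closed, it
holds at `p`. -/
theorem xwBil_nonneg_of_yu_edge {p : E → R} (hp : IsProbVec p) {e : E} (he : ends e = s(y, u))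
    (h0 : 0 ≤ xwBil ends s y o u (Function.update p e 0) (Function.update p e 0)) :
    0 ≤ xwBil ends s y o u p p :=
  XWEdgeYU.xwBil_nonneg_of_dYU_nonneg ends s y o u hp he
    (dYU_nonneg ends s y o u (hp.update e (le_refl 0) zero_le_one)) h0

/-- **The `s–o` edge is removable for (XW)**: if (XW) holds with an edge `e = {s, o}` closed, it
holds at `p`. -/
theorem xwBil_nonneg_of_so_edge {p : E → R} (hp : IsProbVec p) {e : E} (he : ends e = s(s, o))
    (h0 : 0 ≤ xwBil ends s y o u (Function.update p e 0) (Function.update p e 0)) :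
    0 ≤ xwBil ends s y o u p p :=
  XWEdgeYU.xwBil_nonneg_of_dSO_nonneg ends s y o u hp he
    (dYU_nonneg ends y s u o (hp.update e (le_refl 0) zero_le_one)) h0

end Main

/-! ## The residual of the Harris split is never positive -/

section Residual

variable (ends : E → Sym2 V) (s y o u : V)

/-- **The residual of the Harris split is nonpositive**:
`P(Q ∩ a ∩ λ)·P(S ∩ aᶜ ∩ λᶜ) ≤ P(Q ∩ aᶜ ∩ λ)·P(S ∩ a ∩ λᶜ)` — the BHK pair `bhk_pair` at the
swapped marks `(s, u) ↔ (y, o)`, i.e. from the root `s` with `o` avoided, after splitting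
`P(S ∩ λᶜ)` and `P(Q ∩ λ)` along `a`. -/
theorem residualPart_nonpos {p : E → R} (hp : IsProbVec p) :
    XWSplit.residualPart ends s y o u p ≤ 0 := by
  unfold XWSplit.residualPart
  -- the pair at the swapped marks: `P(S ∩ λᶜ)·P(Q ∩ λ ∩ a) ≤ P(Q ∩ λ)·P(S ∩ λᶜ ∩ a)`
  have h := bhk_pair ends y s u o hp
  rw [connEvent_comm ends y s] at h
  set S := connEvent ends s y with hS
  set a := connEvent ends s u with ha
  set l := connEvent ends y o with hl
  -- rewrite the four events of `h` in the `(S, a, l)` order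
  have e1 : Sᶜ ∩ l ∩ a = Sᶜ ∩ a ∩ l := by
    ext ω; simp only [Set.mem_inter_iff]; tauto
  have e2 : S ∩ lᶜ ∩ a = S ∩ a ∩ lᶜ := by
    ext ω; simp only [Set.mem_inter_iff]; tauto
  rw [e1, e2] at h
  -- split `P(S ∩ lᶜ)` and `P(Sᶜ ∩ l)` along `a`
  have f1 : prob p (S ∩ lᶜ ∩ a) + prob p (S ∩ lᶜ ∩ aᶜ) = prob p (S ∩ lᶜ) :=
    prob_inter_add_prob_inter_compl p _ _
  have f2 : prob p (Sᶜ ∩ l ∩ a) + prob p (Sᶜ ∩ l ∩ aᶜ) = prob p (Sᶜ ∩ l) :=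
    prob_inter_add_prob_inter_compl p _ _
  have e3 : S ∩ lᶜ ∩ a = S ∩ a ∩ lᶜ := e2
  have e4 : S ∩ lᶜ ∩ aᶜ = S ∩ aᶜ ∩ lᶜ := by
    ext ω; simp only [Set.mem_inter_iff]; tauto
  have e5 : Sᶜ ∩ l ∩ a = Sᶜ ∩ a ∩ l := e1
  have e6 : Sᶜ ∩ l ∩ aᶜ = Sᶜ ∩ aᶜ ∩ l := by
    ext ω; simp only [Set.mem_inter_iff]; tauto
  rw [e3, e4] at f1
  rw [e5, e6] at f2
  rw [← f1, ← f2] at h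
  nlinarith [prob_nonneg hp (Sᶜ ∩ a ∩ l), prob_nonneg hp (S ∩ a ∩ lᶜ)]

/-- `XW ≤ harrisPart`: the cross W-form never exceeds its Harris part. -/
theorem xwBil_le_harrisPart {p : E → R} (hp : IsProbVec p) :
    xwBil ends s y o u p p ≤ XWSplit.harrisPart ends s y o u p := by
  rw [XWSplit.xwBil_eq_harrisPart_add_residualPart]
  have := residualPart_nonpos ends s y o u hp
  linarith

end Residual

end XWEdgeYUNonneg

end Summit.Ventures.PercRepro2
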